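import Mathlib.Analysis.SpecialFunctions.Pow.Real
import Mathlib.GroupTheory.Perm.Fin
import Literature.Computability.Complexity.ConstantDepth
import Literature.Computability.AlgebraicComplexity.CircuitDepth
import HarnessLib

/-!
# Route `Circuit`, crux `CircuitNpTc0` (stmt-PneNP-0039), line `Sketch`
# (cube-functional threshold dictionary): definitions

Objects posited by the line `Cruxes/CircuitNpTc0/Lines/Sketch.lean` (idea card
`Cruxes/CircuitNpTc0/Ideas/cube-functional-threshold-dictionary.md`), shared by its stub files:

* `wires C` — the number of wires of a Boolean circuit (sum of the arities of its gates, repeated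
  wires counted with multiplicity) and the sparse classes `DepthWires B d w` (depth `≤ d`, `≤ w n`
  wires, basis `B`; no bound on the number of gates is needed: every gate of positive arity costs a
  wire, arity-`0` gates are constants);
* `cubePt`, `CubeComputes`, `CubeDepthEdges k Δ e` — arithmetic circuits over a commutative semiring
  `k` (`Literature.Computability.AlgebraicComplexity.ArithCircuit`, unbounded fan-in `Σ`/`Π` gates)
  computing a Boolean function EXACTLY ON THE CUBE `{0,1}ⁿ`, of product-depth `≤ Δ` and `≤ e n` edges
  (the cube-functional constant-depth model of Forbes–Kumar–Saptharishi 2016 / Raz 2010, size = edges);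
* `WS5` — the word problem of the symmetric group `S₅` (Barrington 1989): a bit string is cut into
  `⌊n/7⌋` blocks of `7` bits, block `i` occupying positions `7i, …, 7i+6`; a block with value `< 120`
  (little-endian) names a permutation of `Fin 5` through `Fintype.equivFin`, every other block (and the
  `n mod 7` trailing bits) denotes the identity; the word is accepted iff the ordered product is `1`;
* `wireBudget c Δ K n = K · (⌈n ^ (1 + c^{-Δ})⌉ + 1)` — the Chen–Tell wire budget at depth `Δ`
  (Chen–Tell, STOC 2019, Thm. 1.1: `n^{1+c^{-d}}` wires).

No statement of the line is made here (the stubs and the composition live in the line file and in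
`Theorems/CircuitCircuitNpTc0*.lean`).
-/

-- `Summit.<Summit>.<Problem>`: for the single-conjunct summit `PneNP` the duplicate `PneNP.PneNP` is mandated (D-0017).
set_option linter.dupNamespace false

namespace Summit.PneNP.PneNP.Cruxes.CircuitNpTc0.Sketch

open Literature.Computability.Complexity Literature.Computability.AlgebraicComplexity

/-! ## Sparse threshold circuits: wires -/

/-- The number of wires of a circuit: the sum of the arities of its gates (a wire read `m` times by a
gate counts `m` times — in the tree's model this is how integer weights of threshold gates arise).
[cite: ImpagliazzoPaturiSaks1997, §1 (wires = edges of the circuit graph)] -/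
def wires {ι : Type*} (C : Circuit ι) : ℕ := (C.gates.map Gate.arity).sum

/-- `DepthWires B d w`: languages decided by circuit families over the basis `B` of `acDepth ≤ d`
(negations free) with at most `w n` wires at length `n`. [cite: ChenTell2019, §1 (TC⁰ circuits of depth d with n^{1+c^{-d}} wires)] -/
noncomputable def DepthWires (B : Set GateFn) (d : ℕ) (w : ℕ → ℕ) : Set (Language Bool) :=
  {L | ∃ C : CircuitFamily, (∀ n, (C n).IsOver B ∧ (C n).acDepth ≤ d ∧ wires (C n) ≤ w n) ∧ C.Decides L}

/-! ## Cube-exact arithmetic circuits -/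

/-- The point of `kⁿ` under a Boolean vector: `true ↦ 1`, `false ↦ 0`. [folklore] -/
def cubePt {k : Type*} [Zero k] [One k] {n : ℕ} (x : Fin n → Bool) : Fin n → k :=
  fun i => if x i then 1 else 0

/-- `CubeComputes P f`: the polynomial computed by the arithmetic circuit `P` takes the value `[f x]`
at every point `x` of the Boolean cube (functional / cube-exact computation in the sense of
Forbes–Kumar–Saptharishi 2016, Def. 1.1; a predicate, not a named fact). [folklore] -/
def CubeComputes {k : Type*} [CommSemiring k] {n : ℕ} (P : ArithCircuit k (Fin n))
    (f : (Fin n → Bool) → Bool) : Prop :=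
  ∀ x : Fin n → Bool, MvPolynomial.eval (cubePt x) P.eval = if f x then 1 else 0

/-- `CubeDepthEdges k Δ e`: languages whose every slice is computed exactly on the cube by an
arithmetic circuit over `k` of product-depth `≤ Δ` with at most `e n` edges (size = number of edges,
as in Raz 2010 and Limaye–Srinivasan–Tavenas 2021). [cite: ForbesKumarSaptharishi2016, Def. 1.1] -/
def CubeDepthEdges (k : Type*) [CommSemiring k] (Δ : ℕ) (e : ℕ → ℕ) : Set (Language Bool) :=
  {L | ∃ F : ∀ n, ArithCircuit k (Fin n),
    ∀ n, (F n).productDepth ≤ Δ ∧ (F n).edgeSize ≤ e n ∧ CubeComputes (F n) (L.sliceFn n)}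

/-! ## The word problem of `S₅` -/

/-- The little-endian value of a `7`-bit block. [folklore] -/
def codeVal (c : Fin 7 → Bool) : ℕ := ∑ j : Fin 7, if c j then 2 ^ (j : ℕ) else 0

/-- `S₅` has `120` elements. [folklore] -/
theorem card_perm_fin_five : Fintype.card (Equiv.Perm (Fin 5)) = 120 := by
  rw [Fintype.card_perm, Fintype.card_fin]; rfl

/-- The permutation named by a `7`-bit block: values `< 120` enumerate `Equiv.Perm (Fin 5)` through
`Fintype.equivFin`, every other value denotes the identity. [cite: Barrington1989, §4 (word problem of S₅ over a fixed letter encoding)] -/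
noncomputable def permOfCode (c : Fin 7 → Bool) : Equiv.Perm (Fin 5) :=
  if h : codeVal c < 120 then
    (Fintype.equivFin (Equiv.Perm (Fin 5))).symm (Fin.cast card_perm_fin_five.symm ⟨codeVal c, h⟩)
  else 1

/-- Position of bit `j` of block `i` in a string of length `n`: `7 i + j`. [folklore] -/
def blockBit (n : ℕ) (i : Fin (n / 7)) (j : Fin 7) : Fin n :=
  ⟨7 * (i : ℕ) + j, by have := i.isLt; have := j.isLt; omega⟩

/-- The ordered product of the `⌊n/7⌋` permutations named by the blocks of a bit vector of length
`n` (trailing `n mod 7` bits are ignored). [cite: Barrington1989, §4] -/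
noncomputable def wordProd (n : ℕ) (x : Fin n → Bool) : Equiv.Perm (Fin 5) :=
  (List.ofFn fun i : Fin (n / 7) => permOfCode fun j => x (blockBit n i j)).prod

/-- **The word problem of `S₅`**: bit strings whose blocks multiply to the identity
(`NC¹`-complete under projections, Barrington 1989). [cite: Barrington1989, Thm. 5 (word problem of a non-solvable group is NC¹-complete)] -/
def WS5 : Language Bool := {x | wordProd x.length x.get = 1}

/-! ## The Chen–Tell wire budget -/

/-- The wire budget `K · (⌈n ^ (1 + c^{-Δ})⌉ + 1)` at depth `Δ` (`c > 1`, constant `K`).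
[cite: ChenTell2019, Thm. 1.1 (n^{1+c^{-d}} wires at depth d)] -/
noncomputable def wireBudget (c : ℝ) (Δ K n : ℕ) : ℕ := K * (⌈(n : ℝ) ^ (1 + (c ^ Δ)⁻¹)⌉₊ + 1)

end Summit.PneNP.PneNP.Cruxes.CircuitNpTc0.Sketch
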